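import Mathlib
import HarnessLib

/-!
# The evaluation presentation of Markman's secant sheaf: block classes and the block-package obstruction (negative lemma for K2ᵀ, rung-1 g7)

Crux `stmt-HodgeConjecture-28148` (K2ᵀ, `Theses.KleimanBFSeeds.TwistNormalisedKleimanSemiregularAnchor`), line
`Cruxes/TwistNormalisedKleimanSemiregularAnchor/Lines/chosen_anchor.lean`, stub `stub_rung_CMclass_d3 : KleimanAnchorRungCM 3`
(and its repaired twin K2ᵀᴿ, `stmt-HodgeConjecture-27388`, step (1½b′) «a rank-8 R♮-framed package `Q ⊂ E|_D`»).
HONEST LABEL: a `--supports` helper (Negative/ lane); it neither proves nor refutes the rung, K2ᵀ, K2ᵀᴿ, `WeilSixfolds`,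
HC_AV, HC_CM or HC. What is KERNEL-CHECKED here is only the rational arithmetic (§2) of the pen chain §1, recorded in the
crux memo `F1-EVAL-PRESENTATION-rung1-g7.md` (same `Cruxes/…Anchor/` directory of the tree); the identification of the
triples below with first Chern classes is PEN (GRR with `td = 1` on abelian varieties), cross-checked against the
independent exact GRR of `CENSUS-5-POINCARE-HALF-SLOPE-rung1-g5.md` §1b.

## §1 The pen chain (what the lemmas are the shadow of)

Markman's upstairs sheaf on `M = X × X̂` (`X = J(C)`, `C` a non-hyperelliptic genus-3 curve, `q = 12`, `13 = q + 1`
curves `C_i` resp. `C′_j` in the two orbits `Z`, `Z′`) is `ℰ = 𝒢₁^∨`, `𝒢 = Φ(F₂ ⊠ F₁)[−3]`, `F₁ = 𝓘_Z(Θ)`, `F₂ = 𝓘_{Z′}(Θ)`,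
with fibre `𝒢₁|_{(x,ξ)} = H¹(X, 𝓘_Z ⊗ 𝓘_{Z′−x} ⊗ M_{x,ξ})`, `M_{x,ξ} = τ_x^*𝒪(Θ) ⊗ 𝒪(Θ) ⊗ P_ξ ≅ 𝒪(2Θ) ⊗ P_{ξ+φ(x)}`
[cite: Markman2025SurveySecant, §11.1–11.2 and Prop. 11.1]. Mayer–Vietoris for `𝓘_{Z′} ⊠ 𝓘_Z = 𝓘_{Z′×X} ∩ 𝓘_{X×Z}` and
the restriction sequence `0 → 𝓘 M → M → M|_{Z ⊔ (Z′−x)} → 0` (`H¹(M) = 0`) give the **evaluation presentation**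

  `[𝒢₁] − [𝒢₂] = [W] + [W′] − [V] − [T]` in `K₀(M)`,   `0 → V → W ⊕ W′ → 𝒢₁ → 0` exact off 169 theta-divisors,

`V` = the rank-8 Fourier–Mukai block (`H⁰(X, M_{x,ξ})`), `W = ⊕_{i=1}^{13} W_i` the FIXED-curve Picard blocks
(`H⁰(C_i, M|)`, rank 4), `W′ = ⊕_{j=1}^{13} W′_j` the MOVING-curve Picard blocks (`H⁰(C′_j − x, M|)`, rank 4), `T` torsion on
the divisors `(C′_j − C_i) × X̂` of generic length 2. GRR (`td = 1`; the Abel–Jacobi curve carries the Poincaré bundle of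
`C`; Mukai `ch 𝒪(2Θ)^∧ = 8 − 4θ̂ + θ̂² − θ̂³/6`; Picard bundle `ch = 4 − θ̂`) gives, in the basis
`(θ₁, θ̂₂, 𝔭) = (p₁^*Θ, p₂^*Θ̂, c₁(𝒫))` with `d_±^*θ̂ = θ₁ + θ̂₂ ± 𝔭`:

  `c₁(V) = (4, −4, −4)`, `c₁(W_i) = (3, −1, −1)`, `c₁(W′_j) = (3, −1, −3)`, `c₁(T_ij) = (2, 0, 0)`,

hence `c₁(𝒢₁) − c₁(𝒢₂) = 13·(3,−1,−1) + 13·(3,−1,−3) − (4,−4,−4) − 169·(2,0,0) = (−264, −22, −48) = −22·Ξ₁ − 48·𝔭`,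
`Ξ₁ = 12θ₁ + θ̂₂` — EXACTLY the hand's independent `c₁(𝒢) = (rk/2)c₁(𝒫) + (2d − 2)Ξ₁`, `rk 𝒢 = −96`
(`blocks_c1_total`, `blocks_c1_total_eq_xi_poincare`); the Poincaré half-slope (THEOREM P½, `Negative/PoincareParity.lean`)
is thereby LOCALISED on the blocks: `(13·1 + 13·3 − 4)/96 = 1/2` (`poincare_slope_of_blocks`). BLOCK PACKAGES: the
presentation yields natural quotients `ℰ|_D ↠ Q_{S,S′} = (W_S ⊕ W′_{S′})^∨|_D` of rank `4(a+b)` (`a = |S|`, `b = |S′|`);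
their normalised class `Δ := c₁(Q) − (rk Q/96)·c₁(ℰ)|_D` is `(−14(a+b), (a+b)/12, b − a)` (`blockPackage_delta`); it is
Poincaré-free iff `a = b` (`blockPackage_poincareFree_iff`) and lies on the `Ξ₁`-ray (the R♮ / LEMMA-H framing
condition «`c₁` on the h-line») for NO `(a,b) ≠ (0,0)` (`no_blockPackage_on_xi_ray`); for the minimal balanced package
`(a,b) = (1,1)` (rank 8 = the R♮ unit rank) the `θ₁`-deficit is exactly `30 = 15 · 2` torsion lengths, after which
`Δ = (1/6)·Ξ₁` (`unitBlockPackage_torsion_deficit`). So an R♮ package on the working member must cut into the Picard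
blocks or absorb torsion sheets — it is never a union of whole blocks.

## §2 What is proved (rational arithmetic on triples `ℚ × ℚ × ℚ`)

`blocks_c1_total`, `blocks_c1_total_eq_xi_poincare`, `poincare_slope_of_blocks`, `blockPackage_delta`,
`blockPackage_poincareFree_iff`, `no_blockPackage_on_xi_ray`, `unitBlockPackage_torsion_deficit`, `rank_count_blocks`.
-/

set_option linter.dupNamespace false

namespace Summit.HodgeConjecture.HodgeConjecture.Theorems.TwistNormalisedKleimanSemiregularAnchor.Negative.EvaluationBlockPackages

/-- **Rank count of the evaluation presentation**: `13·4 + 13·4 − 8 = 96 = 8·q` (`q = 12`): the 26 Picard blocks minus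
the Fourier–Mukai block have the rank of Markman's sheaf (`−χ(𝓘_{Z⊔Z′}(2Θ)) = 26·(6 + 1 − 3) − 8`).
[cite: Markman2025SurveySecant, Prop. 11.1] -/
theorem rank_count_blocks : (13 : ℤ) * 4 + 13 * 4 - 8 = 8 * 12 ∧ (26 : ℤ) * (6 + 1 - 3) - 8 = 96 := by
  norm_num

/-- **LEMMA B, total**: `13·c₁(W_i) + 13·c₁(W′_j) − c₁(V) − 169·c₁(T_ij)` in the basis `(θ₁, θ̂₂, 𝔭)` equals
`(−264, −22, −48)`. [cite: Markman2025SurveySecant, Prop. 11.1] -/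
theorem blocks_c1_total :
    (13 : ℚ) • ((3 : ℚ), (-1 : ℚ), (-1 : ℚ)) + (13 : ℚ) • ((3 : ℚ), (-1 : ℚ), (-3 : ℚ))
      - ((4 : ℚ), (-4 : ℚ), (-4 : ℚ)) - (169 : ℚ) • ((2 : ℚ), (0 : ℚ), (0 : ℚ))
      = ((-264 : ℚ), (-22 : ℚ), (-48 : ℚ)) := by
  norm_num [Prod.ext_iff]

/-- **CROSS-CHECK with the hand's GRR**: `(−264, −22, −48) = −22·Ξ₁ − 48·𝔭` with `Ξ₁ = (12, 1, 0)` (`= 12θ₁ + θ̂₂`,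
type `(1,1,1,12,12,12)`) and `𝔭 = (0, 0, 1)`, i.e. `c₁(𝒢₁) − c₁(𝒢₂) = −(2d − 2)Ξ₁ − (rk ℰ/2)𝔭` at `d = 12`, `rk ℰ = 96`.
[cite: Markman2025SecantWeil, Lemma 6.2.9] -/
theorem blocks_c1_total_eq_xi_poincare :
    ((-264 : ℚ), (-22 : ℚ), (-48 : ℚ))
      = -((2 * 12 - 2 : ℚ)) • ((12 : ℚ), (1 : ℚ), (0 : ℚ)) - ((96 / 2 : ℚ)) • ((0 : ℚ), (0 : ℚ), (1 : ℚ)) := by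
  norm_num [Prod.ext_iff]

/-- **Poincaré half-slope, localised**: the fixed Picard blocks carry `𝔭`-weight `1`, the moving ones `3`, the FM block
`4`; `(13·1 + 13·3 − 4)/96 = 1/2` is the half-integral Poincaré slope of THEOREM P½. [cite: Markman2025SecantWeil, Lemma 6.2.9] -/
theorem poincare_slope_of_blocks : ((13 : ℚ) * 1 + 13 * 3 - 4) / 96 = 1 / 2 := by
  norm_num

/-- **Normalised class of a block package** `Q_{S,S′} = (W_S ⊕ W′_{S′})^∨`, `|S| = a`, `|S′| = b`:
`Δ = −a·c₁(W_i) − b·c₁(W′_j) − (4(a+b)/96)·c₁(ℰ)` with `c₁(ℰ) = (264, 22, 48)` equals `(−14(a+b), (a+b)/12, b − a)`.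
[cite: Markman2025SurveySecant, Prop. 11.1] -/
theorem blockPackage_delta (a b : ℚ) :
    -(a • ((3 : ℚ), (-1 : ℚ), (-1 : ℚ))) - b • ((3 : ℚ), (-1 : ℚ), (-3 : ℚ))
      - (4 * (a + b) / 96) • ((264 : ℚ), (22 : ℚ), (48 : ℚ))
      = (-14 * (a + b), (a + b) / 12, b - a) := by
  ext <;> simp only [Prod.smul_mk, smul_eq_mul, Prod.neg_mk, Prod.mk_sub_mk] <;> ring

/-- **Poincaré balance**: the `𝔭`-component `b − a` of `Δ` vanishes iff the package pairs as many MOVING as FIXED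
blocks. [folklore] -/
theorem blockPackage_poincareFree_iff (a b : ℕ) : ((b : ℚ) - a = 0) ↔ a = b := by
  constructor
  · intro h
    have : (b : ℚ) = a := sub_eq_zero.mp h
    exact_mod_cast this.symm
  · rintro rfl
    simp

/-- **No block package is R♮-framed**: for `(a,b) ≠ (0,0)` the normalised class `(−14(a+b), (a+b)/12, b − a)` is not on
the `Ξ₁ = (12, 1, 0)` ray — the `θ₁`-coefficient is negative while the `θ̂₂`-coefficient is positive.
[cite: Markman2025SurveySecant, Prop. 11.1] -/
theorem no_blockPackage_on_xi_ray (a b : ℕ) (hab : 0 < a + b) :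
    ¬ ∃ t : ℚ, ((-14 * ((a : ℚ) + b), ((a : ℚ) + b) / 12, (b : ℚ) - a) : ℚ × ℚ × ℚ)
        = t • ((12 : ℚ), (1 : ℚ), (0 : ℚ)) := by
  rintro ⟨t, ht⟩
  simp only [Prod.smul_mk, smul_eq_mul, Prod.mk.injEq, mul_one, mul_zero] at ht
  obtain ⟨h1, h2, -⟩ := ht
  have hpos : (0 : ℚ) < (a : ℚ) + b := by exact_mod_cast hab
  -- from `h2`: `t = (a+b)/12 > 0`; from `h1`: `−14(a+b) = 12 t = a + b`, contradiction
  have : -14 * ((a : ℚ) + b) = (a : ℚ) + b := by rw [h1, ← h2]; ring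
  linarith

/-- **Torsion deficit of the minimal balanced package** (`a = b = 1`, rank 8 = the R♮ unit rank): `Δ(1,1) = (−28, 1/6, 0)`;
adding `15` torsion sheets (`c₁(T_ij) = (2,0,0)` each) puts it on the ray: `(−28 + 15·2, 1/6, 0) = (1/6)·(12, 1, 0)`.
[cite: Markman2025SurveySecant, §11.2] -/
theorem unitBlockPackage_torsion_deficit :
    ((-14 * ((1 : ℚ) + 1), ((1 : ℚ) + 1) / 12, (1 : ℚ) - 1) : ℚ × ℚ × ℚ) = ((-28 : ℚ), (1 / 6 : ℚ), (0 : ℚ)) ∧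
    ((-28 : ℚ), (1 / 6 : ℚ), (0 : ℚ)) + (15 : ℚ) • ((2 : ℚ), (0 : ℚ), (0 : ℚ))
      = ((1 / 6 : ℚ)) • ((12 : ℚ), (1 : ℚ), (0 : ℚ)) := by
  refine ⟨by norm_num [Prod.ext_iff], by norm_num [Prod.ext_iff]⟩

/-! ### §3 Packages from Picard-filtration PIECES and torsion sheets (rev 2, appended)

Pen chain (crux memo `F1-EVAL-PRESENTATION-rung1-g7.md` rev 2 §4bis): each Picard block has the evaluation filtration
(sections vanishing at points of the curve), whose successive quotients are line bundles of class `θ₁` (fixed block)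
resp. `θ₁ − 𝔭` (moving block); hence the presentation-visible quotient PIECES of `ℰ|_D` have `c₁ = (1 − r, 1, 1)` (fixed,
rank `r ∈ {2,3,4}`) resp. `(1 − s, 1, s − 1)` (moving, rank `s`), and a torsion sheet has `c₁ = (2, 0, 0)`. For a package of
total rank `R` made of `n = n_f + n_m` pieces (fixed ranks summing to `S_f`, moving to `S_m`) and `m` torsion sheets,
`Δ = (n − R + 2m − 11R/4, n − 11R/48, n_f − n_m + S_m − R/2)`: it lies on the `Ξ₁`-ray iff `2m = 11n + R`
(`piecePackage_on_xi_ray_iff`) and is Poincaré-free iff `S_f − S_m = 2(n_f − n_m)` (`piecePackage_poincareFree_iff`); then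
`Δ = λ·Ξ₁` with `R/48 ≤ λ = n − 11R/48 ≤ 13R/48` (`piecePackage_lambda_bounds`). At the R♮ unit rank `R = 8`: `n = 2`
needs `m = 15`, `n = 4` needs `m = 26`, `n = 3` is impossible (`unit_rank_torsion_counts`); in the `E♯`-frame (`[2]^*`
multiplies `H²` by `4`) the R♮ slope parameter `f = 3·(4λ)/338` takes the values `1/169` resp. `1/13`
(`esharp_frame_f_values`) — the two DESIGN CANDIDATES `EV(4_f,4_m;15)` and `EV(2,2,2,2;26)`, alive in degree `≤ 1`;
the degree-2 row (needs `ch₂` of the torsion sheets and `κ₂`) is the next instrument row. -/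

/-- **Ray criterion for piece packages**: the normalised class `(n − R + 2m − 11R/4, n − 11R/48, ·)` has
`θ₁ : θ̂₂ = 12 : 1` iff `2m = 11n + R`. [cite: Markman2025SurveySecant, Prop. 11.1] -/
theorem piecePackage_on_xi_ray_iff (n R m : ℚ) :
    n - R + 2 * m - 11 * R / 4 = 12 * (n - 11 * R / 48) ↔ 2 * m = 11 * n + R := by
  constructor <;> intro h <;> linarith

/-- **Poincaré balance for piece packages**: the `𝔭`-component `n_f − n_m + S_m − R/2` (`R = S_f + S_m`) vanishes iff
`S_f − S_m = 2(n_f − n_m)`; in particular four rank-2 pieces of any kind, or one fixed and one moving rank-4 block, are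
balanced. [cite: Markman2025SecantWeil, Lemma 6.2.9] -/
theorem piecePackage_poincareFree_iff (nf nm Sf Sm : ℚ) :
    nf - nm + Sm - (Sf + Sm) / 2 = 0 ↔ Sf - Sm = 2 * (nf - nm) := by
  constructor <;> intro h <;> linarith

/-- **Range of the ray coefficient**: with pieces of rank between `2` and `4` (`R/4 ≤ n ≤ R/2`) the coefficient
`λ = n − 11R/48` of `Ξ₁` satisfies `R/48 ≤ λ ≤ 13R/48` (so it is always POSITIVE: quotients of larger slope, `f > 0`).
[folklore] -/
theorem piecePackage_lambda_bounds (n R : ℚ) (h1 : R / 4 ≤ n) (h2 : n ≤ R / 2) :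
    R / 48 ≤ n - 11 * R / 48 ∧ n - 11 * R / 48 ≤ 13 * R / 48 := by
  constructor <;> linarith

/-- **Torsion counts at the R♮ unit rank `R = 8`**: `n = 2` pieces need `m = 15` torsion sheets, `n = 4` need `m = 26`,
and `n = 3` admits no integral `m` (`11·3 + 8 = 41` is odd). [folklore] -/
theorem unit_rank_torsion_counts :
    (2 * (15 : ℤ) = 11 * 2 + 8) ∧ (2 * (26 : ℤ) = 11 * 4 + 8) ∧ ¬ ∃ m : ℤ, 2 * m = 11 * 3 + 8 := by
  refine ⟨by norm_num, by norm_num, ?_⟩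
  rintro ⟨m, hm⟩
  omega

/-- **The two `E♯`-frame slope parameters**: `λ = 1/6` (`n = 2`) and `λ = 13/6` (`n = 4`) give, after `[2]^*` (factor `4`)
and the R♮ identity `Δ = (338/3)·f·h` (RFRAME §2.2, `s = 1/12`), `f = 1/169` resp. `f = 1/13`. [folklore] -/
theorem esharp_frame_f_values :
    (3 : ℚ) * (4 * (1 / 6)) / 338 = 1 / 169 ∧ (3 : ℚ) * (4 * (13 / 6)) / 338 = 1 / 13 ∧
      (2 : ℚ) - 11 * 8 / 48 = 1 / 6 ∧ (4 : ℚ) - 11 * 8 / 48 = 13 / 6 := by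
  norm_num

/-! ### §4 The degree-2 row (rev 3, appended): no presentation-visible package satisfies the R♮ identity in degree 2

Pen chain (crux memo rev 3 §4ter; exact script `f1_degree2_check.py`): with `ch(W_i) = e^{θ₁}(4 − D₊)`,
`ch(W′_j) = e^{θ₁−𝔭}(4 − D₋)`, `ch(V) = e^{θ₁}(8 − 4D₊ + D₊² − D₊³/6)` and the hand's `ch₂(ℰ) = c₁²/192 + κ₂`,
`κ₂ = −(169/48)Ξ₁²` (CENSUS-5 §1b), the K₀ identity gives `ch₂(T_ij) = θ₁(θ₁ − 𝔭)` per torsion sheet — every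
non-`θ₁` monomial cancels exactly (second cross-check of the presentation). For a package `Q`, R♮ in degrees `≤ 2` says that
the NORMALISED character `ch(Q)·e^{−μ}`, `μ = c₁(ℰ)/96 = (11/48)Ξ₁ + 𝔭/2`, lies in `ℚ[h]`, `h = Ξ₁|_D`, with degree-2
coefficient `s·κ₂ − 3f·κ₃`, `s = rk Q/96`, `f` fixed by degree 1 (`λΞ₁ = −2fκ₂Ξ₁`, so `f = 24λ/169`), `κ₃^{sym} =
∓(1859/3456)Ξ₁³`. Torsion pieces (any line-bundle dressing on the torsion divisors) only move `θ₁`-divisible monomials,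
so the `θ̂₂²`-coefficient of the normalised `ch₂` is RIGID: for the balanced whole-block packages `a·(W_i^∨ ⊕ W′_j^∨) ⊕
(torsion)` (the only `𝔭²`-free ones: the `𝔭²`-coefficient is `−Σ(4 − r_k)/8` over the pieces) it is `a·(−143/576)`
(`wholeBlock_thetaHat_sq_coeff`), while R♮ demands `a·(−169/576 ± 22/576)` = `a·(−147/576)` or `a·(−191/576)`
(`rnatural_degree_two_targets`) — never equal (`wholeBlock_package_fails_degree_two`). Hence: on the working member NO
package visible in the evaluation presentation (Picard-filtration pieces + torsion sheets) satisfies the R♮ identities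
through degree 2; an R♮ package, if it exists, is a quotient of `ℰ|_D` that does not factor through the block structure. -/

/-- **`f` from degree 1** (upstairs frame `h = Ξ₁`): `Δ = −2fκ₂·h` with `κ₂ = −169/48` gives `f = 24λ/169`; for the two
degree-1 survivors `λ = 1/6`, `13/6`: `f = 4/169`, `4/13`. [folklore] -/
theorem f_from_degree_one :
    (-2 : ℚ) * (4 / 169) * (-169 / 48) = 1 / 6 ∧ (-2 : ℚ) * (4 / 13) * (-169 / 48) = 13 / 6 ∧
      (24 : ℚ) * (1 / 6) / 169 = 4 / 169 ∧ (24 : ℚ) * (13 / 6) / 169 = 4 / 13 := by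
  norm_num

/-- **The R♮ degree-2 targets** for the rank-`8` unit (`s = 1/12`, `f = 4/169`, `κ₂ = −169/48`, `κ₃ = ∓1859/3456`):
`sκ₂ − 3fκ₃ = −169/576 ± 11/288`, i.e. `−147/576` or `−191/576` (coefficient of `Ξ₁²`, hence of `θ̂₂²`).
[cite: Markman2025SecantWeil, Lemma 6.2.9] -/
theorem rnatural_degree_two_targets :
    (1 / 12 : ℚ) * (-169 / 48) - 3 * (4 / 169) * (1859 / 3456) = -191 / 576 ∧
      (1 / 12 : ℚ) * (-169 / 48) - 3 * (4 / 169) * (-1859 / 3456) = -147 / 576 := by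
  norm_num

/-- **The rigid `θ̂₂²`-coefficient of the balanced whole-block package** `a·(W_i^∨ ⊕ W′_j^∨) ⊕ 15a` torsion sheets
(rank `8a`; `c₁` has `θ̂₂`-coefficient `2a`; `μ` has `θ̂₂`-coefficient `11/48`; the pieces and the torsion contribute no
`θ̂₂²`): `−(11/48)·2a + (8a/2)(11/48)² = a·(−143/576)`. [cite: Markman2025SurveySecant, Prop. 11.1] -/
theorem wholeBlock_thetaHat_sq_coeff (a : ℚ) :
    -(11 / 48 : ℚ) * (2 * a) + (8 * a / 2) * (11 / 48) ^ 2 = a * (-143 / 576) := by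
  ring

/-- **Degree-2 no-go for whole-block packages**: for `a ≠ 0` the rigid coefficient `a·(−143/576)` equals neither R♮
target `a·(−147/576)` nor `a·(−191/576)`. [cite: Markman2025SurveySecant, Prop. 11.1] -/
theorem wholeBlock_package_fails_degree_two (a : ℚ) (ha : a ≠ 0) :
    a * (-143 / 576 : ℚ) ≠ a * (-147 / 576) ∧ a * (-143 / 576 : ℚ) ≠ a * (-191 / 576) := by
  constructor <;> intro h <;> exact ha (by linarith)

/-- **`𝔭²`-coefficient of the normalised `ch₂`** of a Poincaré-balanced piece package is `−Σ(4 − r_k)/8`; with piece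
ranks in `{2,3,4}` each summand is `≥ 0`, so it vanishes iff every piece is a whole block (`r_k = 4`): the two-piece and
four-piece instances. [folklore] -/
theorem poincare_sq_coeff_vanishes_iff_whole_blocks (r₁ r₂ : ℕ) (h₁ : r₁ ≤ 4) (h₂ : r₂ ≤ 4) :
    ((4 - (r₁ : ℚ)) / 8 + (4 - (r₂ : ℚ)) / 8 = 0) ↔ (r₁ = 4 ∧ r₂ = 4) := by
  constructor
  · intro h
    have h₁' : (r₁ : ℚ) ≤ 4 := by exact_mod_cast h₁
    have h₂' : (r₂ : ℚ) ≤ 4 := by exact_mod_cast h₂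
    have e₁ : (r₁ : ℚ) = 4 := by linarith
    have e₂ : (r₂ : ℚ) = 4 := by linarith
    exact ⟨by exact_mod_cast e₁, by exact_mod_cast e₂⟩
  · rintro ⟨rfl, rfl⟩
    norm_num

end Summit.HodgeConjecture.HodgeConjecture.Theorems.TwistNormalisedKleimanSemiregularAnchor.Negative.EvaluationBlockPackages
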